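import Summits.CriticalPhenomena.Ising3DConformalLimit.Theorems.HyperoctahedralRPExistsScaleCovariantLimitFoldedCurrentDefs
import Summits.CriticalPhenomena.Ising3DConformalLimit.Theorems.HyperoctahedralRPExistsScaleCovariantLimitFunnelDoublingIffAxisRate
import Literature.Probability.LatticeModels.TwoPointGradientEstimate
import Literature.Probability.LatticeModels.SharpLengthDCPFromReflected
import Literature.Probability.LatticeModels.CriticalTwoPointBounds
import HarnessLib

/-!
# Line `folded-current-repulsion`: wall repulsion at a positive density of dyadic scales

Lead `prover-line-stmt-CriticalPhenomena-1981-c11-0` (crux `ExistsScaleCovariantLimit`, stmt-CriticalPhenomena-1981), registered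
sub-goal `wallRepulsion_positive_density`. The line's engine F2 `WallRepulsion` says that the limiting wall-avoidance probability of
the folded critical sourced current, which by Aizenman's identity (`stub_foldedIdentity`, `smms_deficit_eq_lim_avoidance`) is the
Messager–Miracle-Solé deficit `av(1;m) := 1 − g(m+2)/g(m)` of the critical axis two-point function `g(m) = ⟨σ₀σ_{me₀}⟩_{β_c(3)}`,
is `≤ A/m` at EVERY scale `m` — equivalent to the open item 6150 (all-scale axis doubling, `wallRepulsion_iff_twoPointDoubling`).
This file proves the unconditional partial result: the bound holds at a POSITIVE DENSITY OF DYADIC SCALES — for all large `n`, at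
least `n` of the exponents `k ∈ [n, 3n+1]` satisfy `av(1; 2^k) ≤ A/2^k` (`wallRepulsion_positive_density`, with `A = 256`).

Mechanism.
* PIGEONHOLE ON DOUBLING (`succ_le_card_good`, real-variable core `pow_card_drops_mul_le`). By the envelopes
  `c‖x‖⁻² ≤ ⟨σ₀σ_x⟩_{β_c} ≤ C‖x‖⁻¹` (`criticalTwoPoint_bounds_holds`, Duminil-Copin 2019 Thm 4.8) read at `x = 2^k e₀`
  (`dyadic_envelopes`: `c ≤ 4^k g(2^k)`, `2^k g(2^k) ≤ C`; `‖2^k e₀‖ = 2^k` in the sup norm), if among the `2n+1` exponents `k ∈ [n, 3n]` at most `n` were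
  doubling-good (`g(2^k) ≤ 64 g(2^{k+1})`), then `≥ n+1` drops by the factor `64` along the nonincreasing sequence `g(2^k)`
  (`Funnel.criticalTwoPoint_axis_antitone`) would give `64^{n+1} g(2^{3n+1}) ≤ g(2^n) ≤ C 2^{-n}`, against
  `g(2^{3n+1}) ≥ c 4^{-(3n+1)}`, i.e. `16 c 2^n ≤ C` — false for `n ≥ ⌈C/c⌉`.
* GOOD ⟹ WALL REPULSION ONE SCALE UP (`avoidance_le_of_doubling`), by the Duminil-Copin–Panis gradient estimate at `β_c(3)`
  (`twoPointFree_gradient_estimate`, valid since `m*(β_c) = 0`, `spontaneousMagnetization_eq_zero_of_le_criticalBeta`, and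
  `⟨·⟩^f_{β_c} = ⟨·⟩⁺_{β_c}` on pairs, `twoPointPlus_criticalBeta_eq_twoPointFree_holds`): `g(m) − g(m+1) ≤ g(j)/(m − j + 1)` for
  `j ≤ m` (`axis_step_le`); with `m = 2^{k+1}`, `j = 2^k` two steps cost `≤ 2 g(2^k)/2^k ≤ 128 g(m)/2^k`, so
  `av(1; 2^{k+1}) ≤ 256/2^{k+1}`.
The map `k ↦ k+1` sends the `≥ n+1` good exponents of `[n, 3n]` injectively into the exponents of `[n+1, 3n+1]` satisfying the bound.

References: H. Duminil-Copin, R. Panis, arXiv:2404.05700 (2025), eq. (1.11); H. Duminil-Copin, *Lectures on the Ising and Potts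
models on the hypercubic lattice* (2019), Thm 4.8; M. Aizenman, Math. Phys. Anal. Geom. 28 (2025) 32, Thm 14.2, §15;
M. Aizenman, H. Duminil-Copin, Ann. Math. 194 (2021), Remark 5.10.
-/

noncomputable section

open Finset
open Literature.Probability.LatticeModels
open Summit.CriticalPhenomena.Ising3DConformalLimit.Theses

namespace Summit.CriticalPhenomena.Ising3DConformalLimit.Cruxes.ExistsScaleCovariantLimit.FoldedCurrentRepulsion

/-! ## Real-variable core: drops of a nonincreasing sequence and the pigeonhole -/

/-- Telescoping along a nonincreasing sequence: each index `i < N` at which the sequence drops by more than the factor `K⁻¹`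
(`¬ (a(i) ≤ K a(i+1))`) costs a factor `K`, so `K^{#drops} · a(N) ≤ a(0)`. [folklore] -/
theorem pow_card_drops_mul_le {a : ℕ → ℝ} {K : ℝ} (hK : 0 ≤ K) (hanti : ∀ i, a (i + 1) ≤ a i) (N : ℕ) :
    K ^ #((range N).filter fun i => ¬ (a i ≤ K * a (i + 1))) * a N ≤ a 0 := by
  induction N with
  | zero => simp
  | succ N ih =>
    rw [range_add_one, filter_insert]
    split_ifs with h
    · -- no drop at `N` (`split_ifs` cases on `a N ≤ K a(N+1)` itself)
      calc K ^ #((range N).filter fun i => ¬ (a i ≤ K * a (i + 1))) * a (N + 1)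
          ≤ K ^ #((range N).filter fun i => ¬ (a i ≤ K * a (i + 1))) * a N :=
          mul_le_mul_of_nonneg_left (hanti N) (pow_nonneg hK _)
        _ ≤ a 0 := ih
    · have hN : N ∉ (range N).filter fun i => ¬ (a i ≤ K * a (i + 1)) := by simp
      rw [card_insert_of_notMem hN, pow_succ]
      calc K ^ #((range N).filter fun i => ¬ (a i ≤ K * a (i + 1))) * K * a (N + 1)
          = K ^ #((range N).filter fun i => ¬ (a i ≤ K * a (i + 1))) * (K * a (N + 1)) := by ring
        _ ≤ K ^ #((range N).filter fun i => ¬ (a i ≤ K * a (i + 1))) * a N :=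
          mul_le_mul_of_nonneg_left (not_le.1 h).le (pow_nonneg hK _)
        _ ≤ a 0 := ih

/-- **Pigeonhole on doubling.** For a nonincreasing nonnegative sequence and `K ≥ 1`: if `a(0) < K^L a(N)` and `L + M ≤ N`, then at
least `M + 1` indices `i < N` are `K`-doubling-good, `a(i) ≤ K a(i+1)` (otherwise the `≥ N − M ≥ L` drops give
`K^L a(N) ≤ a(0)`, `pow_card_drops_mul_le`). [folklore] -/
theorem succ_le_card_good {a : ℕ → ℝ} {K : ℝ} (hK : 1 ≤ K) (hpos : ∀ i, 0 ≤ a i) (hanti : ∀ i, a (i + 1) ≤ a i)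
    {N M L : ℕ} (hL : L + M ≤ N) (hgap : a 0 < K ^ L * a N) :
    M + 1 ≤ #((range N).filter fun i => a i ≤ K * a (i + 1)) := by
  by_contra hlt
  push Not at hlt
  have hsplit : #((range N).filter fun i => a i ≤ K * a (i + 1)) +
      #((range N).filter fun i => ¬ (a i ≤ K * a (i + 1))) = N := by
    rw [card_filter_add_card_filter_not, card_range]
  have hbad : L ≤ #((range N).filter fun i => ¬ (a i ≤ K * a (i + 1))) := by omega
  have htel := pow_card_drops_mul_le (zero_le_one.trans hK) hanti N
  have hmono : K ^ L * a N ≤ K ^ #((range N).filter fun i => ¬ (a i ≤ K * a (i + 1))) * a N :=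
    mul_le_mul_of_nonneg_right (pow_le_pow_right₀ hK hbad) (hpos N)
  linarith

/-! ## The critical axis two-point function of `ℤ³` at dyadic scales -/

/-- **Dyadic envelopes** of the critical axis two-point function `g(m) = ⟨σ₀σ_{me₀}⟩_{β_c(3)}`: `c ≤ 4^k g(2^k)` and
`2^k g(2^k) ≤ C` for every `k`, from `c‖x‖⁻² ≤ ⟨σ₀σ_x⟩_{β_c} ≤ C‖x‖⁻¹` (`criticalTwoPoint_bounds_holds`) at `x = 2^k e₀`,
`‖x‖ = 2^k`. [cite: DuminilCopin2019, Thm. 4.8, §4.4] -/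
theorem dyadic_envelopes : ∃ c C : ℝ, 0 < c ∧ ∀ k : ℕ,
    c ≤ (4 : ℝ) ^ k * criticalTwoPoint 3 (Pi.single 0 ((2 ^ k : ℕ) : ℤ)) ∧
      (2 : ℝ) ^ k * criticalTwoPoint 3 (Pi.single 0 ((2 ^ k : ℕ) : ℤ)) ≤ C := by
  obtain ⟨c, C, hc, hb⟩ := criticalTwoPoint_bounds_holds (d := 3) le_rfl
  refine ⟨c, C, hc, fun k => ?_⟩
  have hnorm : ‖(Pi.single 0 ((2 ^ k : ℕ) : ℤ) : Site 3)‖ = (2 : ℝ) ^ k := by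
    rw [Pi.norm_single, Int.norm_natCast]; norm_num
  have h2k : (0 : ℝ) < (2 : ℝ) ^ k := by positivity
  have h4k : (0 : ℝ) < (4 : ℝ) ^ k := by positivity
  have hx : (Pi.single 0 ((2 ^ k : ℕ) : ℤ) : Site 3) ≠ 0 := by
    rw [← norm_pos_iff, hnorm]; exact h2k
  obtain ⟨hlo, hhi⟩ := hb _ hx
  rw [hnorm] at hlo hhi
  rw [show (-(((3 : ℕ) : ℝ) - 1)) = -2 by norm_num, Real.rpow_neg h2k.le, Real.rpow_two] at hlo
  rw [show (-(((3 : ℕ) : ℝ) - 2)) = -1 by norm_num, Real.rpow_neg_one] at hhi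
  have h4 : ((2 : ℝ) ^ k) ^ 2 = (4 : ℝ) ^ k := by
    rw [← pow_mul, mul_comm, pow_mul]; norm_num
  rw [h4, ← div_eq_mul_inv, div_le_iff₀ h4k] at hlo
  rw [← div_eq_mul_inv, le_div_iff₀ h2k] at hhi
  constructor
  · linarith
  · linarith

/-- **One axial step at criticality** (the Duminil-Copin–Panis gradient estimate at `β = β_c(3)`, where `m*(β_c) = 0` and the free
and plus pair correlations agree): for `j ≤ m`, `g(m) − g(m+1) ≤ g(j)/(m − j + 1)`.
[cite: DuminilCopinPanis2025LowerBounds, eq. (1.11)] -/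
theorem axis_step_le (m j : ℕ) (hjm : j ≤ m) :
    criticalTwoPoint 3 (Pi.single 0 (m : ℤ)) - criticalTwoPoint 3 (Pi.single 0 ((m + 1 : ℕ) : ℤ)) ≤
      criticalTwoPoint 3 (Pi.single 0 (j : ℤ)) / ((m : ℝ) - j + 1) := by
  have hβ : 0 ≤ criticalBeta 3 := criticalBeta_nonneg 3
  have hmag : spontaneousMagnetization 3 (criticalBeta 3) = 0 :=
    spontaneousMagnetization_eq_zero_of_le_criticalBeta le_rfl hβ le_rfl
  have hfree : ∀ x : Site 3, twoPointFree 3 (criticalBeta 3) x = criticalTwoPoint 3 x := fun x =>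
    (twoPointPlus_criticalBeta_eq_twoPointFree_holds (d := 3) le_rfl x).symm
  have h := twoPointFree_gradient_estimate (d := 3) hβ hmag 0 (Pi.single 0 (m : ℤ)) j (by simpa using hjm)
  have hx : (Pi.single 0 (m : ℤ) : Site 3) + Pi.single 0 1 = Pi.single 0 ((m + 1 : ℕ) : ℤ) := by
    rw [← Pi.single_add]; simp
  rw [hx, hfree, hfree, hfree] at h
  simpa using h

/-- **Doubling at one dyadic scale gives wall repulsion one scale up.** If `g(2^k) ≤ 64 g(2^{k+1})`, then
`1 − g(2^{k+1}+2)/g(2^{k+1}) ≤ 256/2^{k+1}`: the two axial steps from `m = 2^{k+1}` with `j = 2^k` (`axis_step_le`) cost at most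
`g(2^k)/(2^k+1) + g(2^k)/(2^k+2) ≤ 2 g(2^k)/2^k ≤ 128 g(m)/2^k`. [folklore] -/
theorem avoidance_le_of_doubling (k : ℕ)
    (hgood : criticalTwoPoint 3 (Pi.single 0 ((2 ^ k : ℕ) : ℤ)) ≤
      64 * criticalTwoPoint 3 (Pi.single 0 ((2 ^ (k + 1) : ℕ) : ℤ))) :
    1 - criticalTwoPoint 3 (Pi.single 0 ((2 ^ (k + 1) + 2 : ℕ) : ℤ)) /
        criticalTwoPoint 3 (Pi.single 0 ((2 ^ (k + 1) : ℕ) : ℤ)) ≤ (256 : ℝ) / 2 ^ (k + 1) := by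
  set g : ℕ → ℝ := fun n => criticalTwoPoint 3 (Pi.single 0 (n : ℤ)) with hg
  have hpos : ∀ n, 0 < g n := fun n => Funnel.criticalTwoPoint_axis_pos 0 n
  -- `j = 2^k`, `2^{k+1} = 2j`
  obtain ⟨j, hj, hm⟩ : ∃ j : ℕ, 2 ^ k = j ∧ 2 ^ (k + 1) = 2 * j := ⟨2 ^ k, rfl, by rw [pow_succ, mul_comm]⟩
  have hjR : (2 : ℝ) ^ k = j := by rw [← hj]; norm_num
  have hjpos : (0 : ℝ) < j := by rw [← hjR]; positivity
  change g (2 ^ k) ≤ 64 * g (2 ^ (k + 1)) at hgood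
  show 1 - g (2 ^ (k + 1) + 2) / g (2 ^ (k + 1)) ≤ 256 / 2 ^ (k + 1)
  rw [pow_succ (2 : ℝ) k, hjR, hm]
  rw [hj, hm] at hgood
  -- two gradient steps from `2j` with anchor `j`
  have h1 := axis_step_le (2 * j) j (by omega)
  have h2 := axis_step_le (2 * j + 1) j (by omega)
  change g (2 * j) - g (2 * j + 1) ≤ g j / (((2 * j : ℕ) : ℝ) - j + 1) at h1
  change g (2 * j + 1) - g (2 * j + 2) ≤ g j / (((2 * j + 1 : ℕ) : ℝ) - j + 1) at h2
  push_cast at h1 h2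
  have hd1 : g j / (2 * (j : ℝ) - j + 1) ≤ g j / j :=
    div_le_div_of_nonneg_left (hpos j).le hjpos (by linarith)
  have hd2 : g j / (2 * (j : ℝ) + 1 - j + 1) ≤ g j / j :=
    div_le_div_of_nonneg_left (hpos j).le hjpos (by linarith)
  have hG := hpos (2 * j)
  have hs : g (2 * j) - g (2 * j + 2) ≤ 2 * (g j / j) := by linarith
  have key : (g (2 * j) - g (2 * j + 2)) * j ≤ 128 * g (2 * j) := by
    have h3 := mul_le_mul_of_nonneg_right hs hjpos.le
    have h4 : 2 * (g j / j) * j = 2 * g j := by field_simp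
    linarith
  have e : 1 - g (2 * j + 2) / g (2 * j) = (g (2 * j) - g (2 * j + 2)) / g (2 * j) := by
    rw [sub_div, div_self hG.ne']
  rw [e, div_le_div_iff₀ hG (mul_pos hjpos two_pos)]
  linarith

/-- **WALL REPULSION AT A POSITIVE DENSITY OF DYADIC SCALES (registered sub-goal `wallRepulsion_positive_density` of the line
`folded-current-repulsion`).** There are `A` (`= 256`) and `n₀` such that for every `n ≥ n₀`, at least `n` of the exponents
`k < 3n + 2` with `k ≥ n` satisfy the limiting wall-avoidance bound `1 − g(2^k+2)/g(2^k) ≤ A/2^k` of the folded critical sourced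
current at distance `2^k` (`g(m) = ⟨σ₀σ_{me₀}⟩_{β_c(3)}`): pigeonhole on doubling against the two-point envelopes
(`succ_le_card_good`, `dyadic_envelopes`) produces `≥ n+1` doubling-good exponents in `[n, 3n]`, and each gives the bound one scale
up by the Duminil-Copin–Panis gradient estimate (`avoidance_le_of_doubling`). The line's open engine `WallRepulsion` (⟺ item 6150)
asks for the bound at ALL scales. -/
theorem wallRepulsion_positive_density : ∃ A : ℝ, ∃ n₀ : ℕ, ∀ n : ℕ, n₀ ≤ n →
    n ≤ #((Finset.range (3 * n + 2)).filter fun k => n ≤ k ∧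
      1 - criticalTwoPoint 3 (Pi.single 0 ((2 ^ k + 2 : ℕ) : ℤ)) / criticalTwoPoint 3 (Pi.single 0 ((2 ^ k : ℕ) : ℤ)) ≤
        A / 2 ^ k) := by
  obtain ⟨c, C, hc, henv⟩ := dyadic_envelopes
  refine ⟨256, ⌈C / c⌉₊, fun n hn => ?_⟩
  set g : ℕ → ℝ := fun m => criticalTwoPoint 3 (Pi.single 0 (m : ℤ)) with hg
  have hpos : ∀ m, 0 < g m := fun m => Funnel.criticalTwoPoint_axis_pos 0 m
  have hanti : Antitone g := Funnel.criticalTwoPoint_axis_antitone 0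
  -- (1) the envelope gap between the scales `2^n` and `2^{3n+1}`: `g(2^n) < 64^{n+1} g(2^{3n+1})`
  have hgap : g (2 ^ (n + 0)) < (64 : ℝ) ^ (n + 1) * g (2 ^ (n + (2 * n + 1))) := by
    rw [Nat.add_zero, show n + (2 * n + 1) = 3 * n + 1 by ring]
    obtain ⟨-, hup⟩ := henv n
    obtain ⟨hlow, -⟩ := henv (3 * n + 1)
    change (2 : ℝ) ^ n * g (2 ^ n) ≤ C at hup
    change c ≤ (4 : ℝ) ^ (3 * n + 1) * g (2 ^ (3 * n + 1)) at hlow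
    have hCn : C ≤ c * n := by
      have h1 : C / c ≤ n := (Nat.le_ceil (C / c)).trans (by exact_mod_cast hn)
      rwa [div_le_iff₀ hc, mul_comm] at h1
    have hn2 : (n : ℝ) < (2 : ℝ) ^ n := by exact_mod_cast Nat.lt_two_pow_self
    have h64 : (4 : ℝ) ^ (3 * n + 1) ≤ (64 : ℝ) ^ (n + 1) :=
      calc (4 : ℝ) ^ (3 * n + 1) ≤ (4 : ℝ) ^ (3 * (n + 1)) := pow_le_pow_right₀ (by norm_num) (by omega)
        _ = (64 : ℝ) ^ (n + 1) := by rw [pow_mul]; norm_num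
    have hpos2 : (0 : ℝ) < (2 : ℝ) ^ n := by positivity
    have hX : 0 ≤ g (2 ^ (3 * n + 1)) := (hpos _).le
    have h4 : (4 : ℝ) ^ (3 * n + 1) * g (2 ^ (3 * n + 1)) ≤ (64 : ℝ) ^ (n + 1) * g (2 ^ (3 * n + 1)) :=
      mul_le_mul_of_nonneg_right h64 hX
    have h5 := mul_le_mul_of_nonneg_left (hlow.trans h4) hpos2.le
    have h6 : c * (n : ℝ) < c * (2 : ℝ) ^ n := mul_lt_mul_of_pos_left hn2 hc
    have key : (2 : ℝ) ^ n * g (2 ^ n) < (2 : ℝ) ^ n * ((64 : ℝ) ^ (n + 1) * g (2 ^ (3 * n + 1))) := by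
      linarith
    exact lt_of_mul_lt_mul_left key hpos2.le
  -- (2) pigeonhole: at least `n + 1` doubling-good exponents `n + i`, `i ≤ 2n`
  have hT : n + 1 ≤ #((range (2 * n + 1)).filter fun i => g (2 ^ (n + i)) ≤ 64 * g (2 ^ (n + (i + 1)))) :=
    succ_le_card_good (a := fun i => g (2 ^ (n + i))) (K := 64) (by norm_num) (fun i => (hpos _).le)
      (fun i => hanti (Nat.pow_le_pow_right two_pos (by omega))) (by omega) hgap
  -- (3) `i ↦ n + i + 1` maps the good exponents injectively into the scales with wall repulsion
  have hTS : #((range (2 * n + 1)).filter fun i => g (2 ^ (n + i)) ≤ 64 * g (2 ^ (n + (i + 1)))) ≤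
      #((Finset.range (3 * n + 2)).filter fun k => n ≤ k ∧
        1 - criticalTwoPoint 3 (Pi.single 0 ((2 ^ k + 2 : ℕ) : ℤ)) / criticalTwoPoint 3 (Pi.single 0 ((2 ^ k : ℕ) : ℤ)) ≤
          (256 : ℝ) / 2 ^ k) := by
    refine card_le_card_of_injOn (fun i => n + i + 1) (fun i hi => ?_) (fun a _ b _ hab => ?_)
    · rw [Finset.mem_coe, Finset.mem_filter, Finset.mem_range] at hi
      simp only [Finset.mem_coe, Finset.mem_filter, Finset.mem_range]
      refine ⟨by omega, by omega, ?_⟩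
      exact avoidance_le_of_doubling (n + i) hi.2
    · have hab' : n + a + 1 = n + b + 1 := hab
      omega
  calc n ≤ n + 1 := Nat.le_succ n
    _ ≤ _ := hT
    _ ≤ _ := hTS

end Summit.CriticalPhenomena.Ising3DConformalLimit.Cruxes.ExistsScaleCovariantLimit.FoldedCurrentRepulsion

end
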